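import Mathlib
import HarnessLib.Audit
import Summits.PneNP.PneNP.Theorems.PstarChordBridgeBasis

/-!
# Pointwise versions of R5 / (★★) for state-dependent reads (ROUND-24, memo §9 O2 / §10 "non-constant reads"; groundwork)

FRONTIER range-avoidance ladder, rung F-N3, ROUND 24 (cell `pnp-ideate`, planner memo `r24/CORE-BOUND-NOTES.md` §10 ("NON-CONSTANT READS …
`Z ⊆ {r_e = 1} ∪ {ρ_{1e} = ρ'_{1e} = 0}` … (★★) weakens to `f_e · (read-indicator) ∈ I(Z)`"), §9 O2; restricted-model proof complexity — nothing here
bears on `P` versus `NP`).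

The closed R-chain (`PstarChordBridgeFive`) assumes PRIVATES UNREAD, which makes every read vector `ρ_e(a)` constant in the base point `a`
(`PstarChordBridgeForcing.const_of_unread`); constancy is used exactly twice — in R5 (`PstarChordSystem.not_killable_pair` /
`direction_collapse`) and in (★★) (`PstarChordSystem.star_star`).  The model itself (`PstarChordSystem.ChordSystem`) already lets the read
vectors depend on `a` (in the instance they are the affine read coefficients `PstarChordBridgeTools.coef`: `[p ∈ C] + Σ_{readers (p,z)} x_z`).
This file records what survives WITHOUT constancy, pointwise:

* `not_killable_pair_at` — **R5 pointwise**: in an infeasible chord system, at a base point where two distinct chords are both killable, their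
  non-zero read vectors AT THAT POINT coincide (any two of them);
* `forced_of_read_dir` — **(★★) pointwise, instance form**: for bridge data whose read vectors lie pointwise on a line `{0, m}` (`m ≠ 0`) and
  whose model is infeasible, every chord `e ∈ N` satisfies `Q_{D e}(x) = γ_e + 1` at every `x` with `q_m(x) = 0` WHERE `e` IS READ
  (`ρ_e(x) ≠ 0 ∨ ρ'_e(x) ≠ 0`) — i.e. the chord form is forced on `Z(q_m) ∩ {read region}`, the input of the affine-subspace forcing tools of
  `PstarQuadRestrict` (`forcing_cases_restrict` / `classification_restrict`) when the read region is a hyperplane (one gate reader).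

With constant reads and M-read (`read_of_chordMinimal`) the second statement is `star_star`; the gate family of memo §10.1 (`w₂ = pin σ`,
read coefficient `1 + a_τ`) is the first configuration where the pointwise form is strictly weaker.
-/

set_option linter.dupNamespace false -- `Summit.PneNP.PneNP.…`: summit = sub-problem name (D-0017 single-conjunct layout)

open Finset Module Literature.Computability.Complexity
open Summit.PneNP.PneNP.Theorems.PstarProductRank (qform)
open Summit.PneNP.PneNP.Theorems.PstarReadSumset (V2 Reach)
open Summit.PneNP.PneNP.Theorems.PstarChordSystem (ChordSystem)
open Summit.PneNP.PneNP.Theorems.PstarChordSystemMap (mapSys toX mapSys_u mapSys_ρ mapSys_ρ' toX_injective singleRead_mapSys_toX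
  infeasible_mapSys)
open Summit.PneNP.PneNP.Theorems.PstarChordBridgeTools
open Summit.PneNP.PneNP.Theorems.PstarChordBridge
open Summit.PneNP.PneNP.Theorems.PstarChordBridgeForcing (gam sys_u_eq)
open Summit.PneNP.PneNP.Theorems.PstarChordBridgeBasis (qDir q_dir)

namespace Summit.PneNP.PneNP.Theorems.PstarChordBridgePointwise

/-! ## R5 pointwise -/

section Model

variable {ι A : Type*} [DecidableEq ι]

/-- **R5 pointwise.**  In an infeasible chord system, at a base point `a` where the distinct chords `e, e'` are both killable, a non-zero read
vector of `e` at `a` and a non-zero read vector of `e'` at `a` are equal (else the four states reach all of `𝔽₂²`). -/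
theorem not_killable_pair_at (S : ChordSystem ι A) {E : Finset ι} (hI : S.Infeasible E) {e e' : ι} (he : e ∈ E) (he' : e' ∈ E)
    (hne : e ≠ e') (a : A) {x y : V2} (hx : x = S.ρ e a ∨ x = S.ρ' e a) (hy : y = S.ρ e' a ∨ y = S.ρ' e' a) (hx0 : x ≠ 0) (hy0 : y ≠ 0)
    (hxy : x ≠ y) : ¬ (S.u e a = 0 ∧ S.u e' a = 0) := by
  rintro ⟨hu, hu'⟩
  apply S.not_reach_of_infeasible hI a
  have heK : e ∈ E.filter (fun e => S.u e a = 0) := mem_filter.2 ⟨he, hu⟩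
  have heK' : e' ∈ E.filter (fun e => S.u e a = 0) := mem_filter.2 ⟨he', hu'⟩
  have hx' : x = (fun e => S.ρ e a) e ∨ x = (fun e => S.ρ' e a) e := hx
  have hy' : y = (fun e => S.ρ e a) e' ∨ y = (fun e => S.ρ' e a) e' := hy
  generalize S.t + S.F a + ∑ e ∈ E.filter (fun e => ¬ S.u e a = 0), (S.ρ e a + S.ρ' e a) = v
  rcases PstarReadSumset.span_two hx0 hy0 hxy v with h | h | h | h <;> rw [h]
  · simpa using PstarReadSumset.reach_pair _ _ _ heK heK' hne (x := 0) (y := 0) (Or.inl rfl) (Or.inl rfl)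
  · simpa using PstarReadSumset.reach_pair _ _ _ heK heK' hne (x := x) (y := 0) (Or.inr hx') (Or.inl rfl)
  · simpa using PstarReadSumset.reach_pair _ _ _ heK heK' hne (x := 0) (y := y) (Or.inl rfl) (Or.inr hy')
  · exact PstarReadSumset.reach_pair _ _ _ heK heK' hne (Or.inr hx') (Or.inr hy')

/-- **(★★) pointwise, model form**: if every read vector lies pointwise on the line `{0, m}` (`m ≠ 0`) and the system is infeasible, then in the
basis-changed system `toX m` a chord of `E` that is read at a point of `Z = {q_m = 0}` is forced ON there. -/
theorem forced_of_read_toX (S : ChordSystem ι A) {E : Finset ι} (hI : S.Infeasible E) {m : V2} (hm : m ≠ 0)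
    (hU1 : ∀ e a, (S.ρ e a = 0 ∨ S.ρ e a = m) ∧ (S.ρ' e a = 0 ∨ S.ρ' e a = m)) {e : ι} (he : e ∈ E) {a : A}
    (hZ : ((mapSys S (toX m)).F a).2 = (mapSys S (toX m)).t.2) (hread : S.ρ e a ≠ 0 ∨ S.ρ' e a ≠ 0) : S.u e a = 1 := by
  have hSR := singleRead_mapSys_toX S hU1
  have hinf := infeasible_mapSys S (toX_injective hm) hI
  have hread' : (mapSys S (toX m)).Read e a := by
    unfold ChordSystem.Read
    rw [mapSys_ρ, mapSys_ρ']
    rcases hread with h | h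
    · exact Or.inl fun h0 => h (toX_injective hm (by rw [h0, map_zero]))
    · exact Or.inr fun h0 => h (toX_injective hm (by rw [h0, map_zero]))
  have h := (mapSys S (toX m)).forced_of_read hSR hinf he hZ hread'
  rwa [mapSys_u] at h

end Model

/-! ## (★★) pointwise, instance form -/

variable {n m : ℕ}

/-- **(★★) pointwise for bridge data.**  Reads pointwise on a line `{0, m}`, `m ≠ 0`, model infeasible: for every chord `e ∈ N` and every base
point `x` with `q_m(x) = 0` at which `e` is read, `Q_{D e}(x) = γ_e + 1`.  No constancy of reads, no chord-minimality needed. -/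
theorem forced_of_read_dir (I : LocalMap 4 n m) (B : BridgeData n m) (hinf : (sys I B).Infeasible B.N) {mv : V2} (hm : mv ≠ 0)
    (hU1 : ∀ e a, ((sys I B).ρ e a = 0 ∨ (sys I B).ρ e a = mv) ∧ ((sys I B).ρ' e a = 0 ∨ (sys I B).ρ' e a = mv))
    {e : Fin m} (he : e ∈ B.N) {x : Fin n → ZMod 2} (hZ : qDir I B mv x = 0) (hread : (sys I B).ρ e x ≠ 0 ∨ (sys I B).ρ' e x ≠ 0) :
    qform (B.D e) (fun j => I.vars j 2) (fun j => I.vars j 3) x = gam B e + 1 := by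
  have hZ' : ((mapSys (sys I B) (toX mv)).F x).2 = (mapSys (sys I B) (toX mv)).t.2 := by
    have h := q_dir I B mv x
    rw [hZ] at h
    have e2 : ∀ a b : ZMod 2, a + b = 0 → a = b := by decide
    exact e2 _ _ h
  have h := forced_of_read_toX (sys I B) hinf hm hU1 he hZ' hread
  rw [sys_u_eq] at h
  have e1 : ∀ g Q : ZMod 2, g + Q = 1 → Q = g + 1 := by decide
  exact e1 _ _ h

end Summit.PneNP.PneNP.Theorems.PstarChordBridgePointwise
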